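import Mathlib
import HarnessLib
import Summits.ValiantsHypothesis.ValiantsHypothesis.Theorems.LacunarySymmetroidMatrixDescartesProductPlusOneSeparatingWeightMeanPivot

/-!
# ValiantsHypothesis / LacunarySymmetroid — crux `MatrixDescartes` (stmt-ValiantsHypothesis-18050, V1),
# LINE (A) «product_plus_one»: the COMMON-OUTER-SHAPE sector — EVERY `K`, EVERY COUPLING `l₀` (in particular the MIDDLE coupling)

A consequence of the mean-pivot law ✓ `sepWeight_meanPivot_eulerNumerator_le` that needs NO sign bookkeeping at all.  Fix the coupled
letter `l₀` and suppose the rows share a COMMON OUTER SHAPE: `a_{jl} = s_j·t_l` for every `l ≠ l₀` (the coupled letters `a_{j l₀}` are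
ARBITRARY, the scales `s_j ≠ 0` are arbitrary).  Then the stripped rows are proportional, `B_j = s_j·T₁`, `B⁽²⁾_j = s_j·T₂` with
`T₁(z) = Σ_{l≠l₀} (d_l − d_{l₀}) t_l z^{d_l}`, `T₂(z) = Σ_{l≠l₀} (d_l − d_{l₀})² t_l z^{d_l}`, and the pivot `μ = T₂(z)/T₁(z)` annihilates
`B⁽²⁾_j − μ B_j` for EVERY row simultaneously: every positive zero of `eulerNumerator d a l₀` off the poles with `T₁(z) ≠ 0` is a strict
down-crossing.  When the outer stripped shape has one sign (`(d_l − d_{l₀})·t_l < 0` for all `l ≠ l₀` — e.g. the MIDDLE coupling of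
`K = 3` with outer letters `t_0 > 0 > t_2`, ANY middle letters; or the bottom coupling with a negative tail, ✓ `sepWeight_proportionalTails_le`)
`T₁ < 0` on `(0,∞)` and the global law applies:

* ★★★ `sepWeight_commonOuterShape_le` — every `(m, K)`, every support, every coupling `l₀`: `Z₊(eulerNumerator d a l₀) ≤ B + (B + 1)` for any
  bound `Z₊(∏ f_j) ≤ B` (`= m` when the rows have one sign change).  For `K = 3`, `l₀ = 1` this is a linear row AT THE MIDDLE COUPLING for
  every company `f_j = s_j(t_0 X^{d_0} + t_2 X^{d_2}) + a_{j1} X^{d_1}` (`t_0 t_2 < 0`; all four no-dip/dip sign types occur as `s_j`, `a_{j1}`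
  vary) — the skeleton lists «middle coupling in the no-dip sector» in the residue of `stub_classRowK3` / `stub_eulerBoundK3`.

HONEST FRAMING: a sector theorem for the research stubs `stub_eulerBoundK3` / `stub_classRowK3` / `stub_polyLaw`; NOT those stubs, not
`MatrixDescartes`; `VP ≠ VNP` is NOT proved.  No definitions, no named facts, no sorry.
-/

set_option linter.dupNamespace false

namespace Summit.ValiantsHypothesis.ValiantsHypothesis.Theorems.LacunarySymmetroidMatrixDescartes

namespace ProductPlusOne

open Polynomial Finset
open scoped BigOperators

/-- ★★★ **THE COMMON-OUTER-SHAPE SECTOR** (every `(m, K)`, every support `d`, every coupling `l₀`): rows `a_{jl} = s_j t_l` for `l ≠ l₀`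
(`s_j ≠ 0`; coupled letters `a_{j l₀}` arbitrary), outer stripped shape of one sign (`(d_l − d_{l₀})·t_l < 0` for `l ≠ l₀`, some `l ≠ l₀`):
`Z₊(eulerNumerator d a l₀) ≤ B + (B + 1)` for any bound `Z₊(∏ f_j) ≤ B`, provided `∏ f_j ≠ 0`. [this file's theorem] -/
theorem sepWeight_commonOuterShape_le {m K : ℕ} (d : Fin K → ℕ) (a : Fin m → Fin K → ℝ) (l₀ : Fin K)
    (t : Fin K → ℝ) (s : Fin m → ℝ) (hs : ∀ j, s j ≠ 0) (htail : ∀ j, ∀ l, l ≠ l₀ → a j l = s j * t l)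
    (hK : ∃ l : Fin K, l ≠ l₀) (hT : ∀ l, l ≠ l₀ → ((d l : ℝ) - d l₀) * t l < 0)
    (hP0 : (∏ j, ∑ l, C (a j l) * X ^ (d l) : ℝ[X]) ≠ 0) (B : ℕ) (hZ : ((∏ j, ∑ l, C (a j l) * X ^ (d l) : ℝ[X]).roots.toFinset.filter (fun t => 0 < t)).card ≤ B) :
    ((∑ j, (∑ l, C (a j l * ((d l : ℝ) - d l₀)) * X ^ (d l)) * ∏ i ∈ Finset.univ.erase j, (∑ l, C (a i l) * X ^ (d l)) : ℝ[X]).roots.toFinset.filter (fun t => 0 < t)).card ≤ B + (B + 1) := by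
  classical
  refine sepWeight_meanPivot_eulerNumerator_le d a l₀ hP0 B hZ (fun z hz _hg _hEz => ?_)
  -- the outer stripped shape is negative at `z`
  have hT1 : (∑ l, ((d l : ℝ) - d l₀) * t l * z ^ (d l)) < 0 := by
    obtain ⟨l₁, hl₁⟩ := hK
    have hterm : ∀ l ∈ Finset.univ.erase l₁, ((d l : ℝ) - d l₀) * t l * z ^ (d l) ≤ 0 := by
      intro l _
      by_cases hl : l = l₀
      · subst hl; simp
      · exact (mul_neg_of_neg_of_pos (hT l hl) (by positivity)).le
    have hlt : ((d l₁ : ℝ) - d l₀) * t l₁ * z ^ (d l₁) < 0 := mul_neg_of_neg_of_pos (hT l₁ hl₁) (by positivity)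
    rw [← Finset.sum_erase_add _ _ (Finset.mem_univ l₁)]
    have := Finset.sum_nonpos hterm
    linarith
  -- the stripped rows are proportional to the outer shape
  have h1 : ∀ j : Fin m, (∑ l, ((d l : ℝ) - d l₀) * a j l * z ^ (d l)) = s j * (∑ l, ((d l : ℝ) - d l₀) * t l * z ^ (d l)) := by
    intro j
    rw [Finset.mul_sum]
    refine Finset.sum_congr rfl (fun l _ => ?_)
    by_cases hl : l = l₀
    · subst hl; simp
    · rw [htail j l hl]; ring
  have h2 : ∀ j : Fin m, (∑ l, ((d l : ℝ) - d l₀) ^ 2 * a j l * z ^ (d l)) = s j * (∑ l, ((d l : ℝ) - d l₀) ^ 2 * t l * z ^ (d l)) := by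
    intro j
    rw [Finset.mul_sum]
    refine Finset.sum_congr rfl (fun l _ => ?_)
    by_cases hl : l = l₀
    · subst hl; simp
    · rw [htail j l hl]; ring
  refine ⟨(∑ l, ((d l : ℝ) - d l₀) ^ 2 * t l * z ^ (d l)) / (∑ l, ((d l : ℝ) - d l₀) * t l * z ^ (d l)), fun j => ⟨?_, ?_⟩⟩
  · rw [h1 j, h2 j]
    have hdiv : (∑ l, ((d l : ℝ) - d l₀) ^ 2 * t l * z ^ (d l)) / (∑ l, ((d l : ℝ) - d l₀) * t l * z ^ (d l)) * (s j * (∑ l, ((d l : ℝ) - d l₀) * t l * z ^ (d l))) = s j * (∑ l, ((d l : ℝ) - d l₀) ^ 2 * t l * z ^ (d l)) := by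
      calc (∑ l, ((d l : ℝ) - d l₀) ^ 2 * t l * z ^ (d l)) / (∑ l, ((d l : ℝ) - d l₀) * t l * z ^ (d l)) * (s j * (∑ l, ((d l : ℝ) - d l₀) * t l * z ^ (d l))) = s j * (∑ l, ((d l : ℝ) - d l₀) ^ 2 * t l * z ^ (d l)) * ((∑ l, ((d l : ℝ) - d l₀) * t l * z ^ (d l)) / (∑ l, ((d l : ℝ) - d l₀) * t l * z ^ (d l))) := by ring
        _ = s j * (∑ l, ((d l : ℝ) - d l₀) ^ 2 * t l * z ^ (d l)) := by rw [div_self hT1.ne, mul_one]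
    rw [hdiv, sub_self, mul_zero]
  · rw [h1 j]
    exact mul_ne_zero (hs j) hT1.ne

end ProductPlusOne

end Summit.ValiantsHypothesis.ValiantsHypothesis.Theorems.LacunarySymmetroidMatrixDescartes
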